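import Literature.AlgebraicGeometry.ModuliOfAbelianVarieties.SiegelAdmissibleMarkingReadingTransport
import Literature.AlgebraicGeometry.ShimuraVarieties.UnitaryBallQuotientDatum
import Literature.Geometry.ComplexAnalytic.RelativeExponentialUniformisation
import Literature.AlgebraicGeometry.AbelianSchemes.AbelianSchemeFibreHom
import HarnessLib

/-!
# COV-5 «CHART COMPATIBILITY»: two admissibly-marked relative exponential charts at ONE point of the base, whose period points are
# related by a level transport `M ∈ Γ_δ(N)` commuting with an integral endomorphism `A`, read `A` compatibly
# ([Lange2023AbelianVarietiesComplex] Prop. 3.1.4; [Milne2005ShimuraVarieties] Thm. 6.11; [Shimura1963AnalyticFamilies] §2)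

Topic `Literature/AlgebraicGeometry/ModuliOfAbelianVarieties`; namespace `Literature.AlgebraicGeometry.ModuliOfAbelianVarieties`.
THEOREMS ONLY (no definition, no named fact, no instance, no notation, no `sorry`).  Sequel of ★ MRK-READ
`SiegelAdmissibleMarkingReadingTransport` (A-p06 (g33)).  Cell `hodgecm-mathlib` (D-0151), FLOOR 0, P6 «MOD» (crux hLiu418 =
stmt-HodgeConjecture-24832, `--supports`), E6 closer of `Cruxes/HLiu418/Lines/F0_P6a_PELWitnessE.lean`, socket Σ-AN `ReadsCReading`, census
row **COV-5 `hcompat`** of `CENSUS-SigmaAN.v1` (A-p06 (g33)): the `hcompat` hypothesis of ★ E6-an′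
`AbelianSchemeOver.exists_isMonHom_of_chartReadings_of_additive` for two ★ P-3 `siegelUniversalFamilyUniformisation` charts at a common point
`t`, in the EXACT currencies the assembler holds — (ADM) data of the two charts at `t` (unit frames, tautological complex coordinates, torus map
`=` chart fibre map read in the total space), the period transport `(M, L)` of ★ `AuxChartGS.Z_equivariant` in its REL form
`L ∘ Π_Z = Π_{Z′} ∘ M` (no Möbius action in the hypothesis), and the `ℂ`-linear avatars of ★ `AuxChartGS.Mρ_kottwitz`.  HC_CM is proved only
modulo the printed citations (2 remaining named inputs hLiu418 24832, h413 24833) until rung 0 closes; this file is generic and changes no count.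

THE MATHEMATICS.  (§1, the BRIDGE) If `L ∘ Π_Z = Π_{Z′} ∘ M` for a `ℂ`-linear automorphism `L` of `ℂ^g`, `Π_Z (x, y) = Z x + Δ y` the Siegel
period map, and `M ∈ Sp_δ(ℤ)`, then, as complex `g × 2g` matrices, `L (Z, Δ) = (Z′, Δ) M` (★ `SiegelModuli.rel_iff_matrix`), whence
`Z′ = gDHom(M) • Z` for Lange՚s action of `Sp_δ(ℤ)` on `𝔥_g` through `G_D` ([Lange2023AbelianVarietiesComplex] Prop. 3.1.4 (i) ⇒ (ii), ★
`SiegelModuli.moeb_toGD_eq_of_rel`) — the `hZZ′` currency of ★ MRK-UNIQ ∕ MRK-TRANSPORT ∕ MRK-READ.  (§2) ★ MRK-READ then says that an integral `A`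
commuting with `M` reads the same through two admissible markings `m` (at `Z`) and `m′` (at `Z′`) of ONE fibre with unit frames:
`toFun (π z) = toFun′ (π z′) ⟹ toFun (π (C z)) = toFun′ (π (C′ z′))` for the avatars `C Π_Z = Π_Z A_ℝ`, `C′ Π_{Z′} = Π_{Z′} A_ℝ`; (§3) when the two
torus maps ARE the fibre maps `e`, `e′` of two relative exponential charts read in the total space of the abelian scheme through an injective
`φA` (the (ADM) clause of ★ P-3), this is literally `e z = e′ z′ ⟹ e (C z) = e′ (C′ z′)` — E6-an′՚s `hcompat` at the point.  (§4) On a piece of the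
record curve uniformised by a ball quotient `B` ([BergeronMillsonMoeglin2016Balls] Part 2 §1), two lifts `v`, `v′` of one point differ by
`γ ∈ Γ_B` up to `ℂˣ` (field `unif_eq_unif_iff`); read through an identification `Γ_B^{τ₁} = Γ′^{τ}` of the ball level with an `L`-rational level
`Γ′` (the `pieces` clause of ★ `RecordSystemGS`) this is the binder shape `γ^{τ} v = c • v′`, `γ ∈ Γ′`, of ★ `AuxChartGS.Z_equivariant`.

* §1 **`SiegelModuli.gDHom_smul_eq_of_periodMap_rel`**, `SiegelModuli.eq_gDHom_smul_of_periodMap_rel` (the `hZZ′` orientation),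
  `SiegelModuli.exists_eq_gDHom_smul_of_exists_periodMap_rel` (existential ∕ `unif_iff` shape).
* §2 **`SiegelAdelicMarking.toFun_cover_apply_eq_of_toFun_cover_eq_of_periodMap_rel`** — MRK-READ with the transport in REL form and the
  avatars in `Π_Z`-form.
* §3 **`SiegelAdelicMarking.chart_apply_eq_of_chart_eq_of_periodMap_rel`** — THE HEAD: `e z = e′ z′ → e (C z) = e′ (C′ z′)` for chart fibre
  maps read in a total space (`hcompat` of ★ E6-an′ at one point).
* §4 **`UnitaryBallUniformisationDatum.exists_mem_map_mulVec_eq_smul_of_unif_eq`** — level transport of two lifts on a ball-quotient piece.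

## References
* [Lange2023AbelianVarietiesComplex] H. Lange, *Abelian Varieties over the Complex Numbers* (2023), §3.1.2 Prop. 3.1.4, §3.1.4 (3.8).
* [Milne2005ShimuraVarieties] J. S. Milne, *Introduction to Shimura Varieties* (2005; rev. 2017), §6 Thm. 6.11 pp. 74–75, Lemma 5.13 p. 57.
* [Shimura1963AnalyticFamilies] G. Shimura, *On analytic families of polarized abelian varieties and automorphic functions*, Ann. Math. 78 (1963), §2.
* [BergeronMillsonMoeglin2016Balls] N. Bergeron, J. Millson, C. Moeglin, *The Hodge conjecture and arithmetic quotients of complex balls*,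
  Acta Math. 216 (2016), Part 2 §§1.1–1.4.
-/

set_option autoImplicit false

noncomputable section

open Matrix CategoryTheory AlgebraicGeometry Topology
open Literature.AlgebraicGeometry.Motives (AbelianVariety AlgPoints CartierDivisor SchemeOver ComplexPoints)
open Literature.AlgebraicGeometry.AbelianSchemes (AbelianSchemeOver)
open Literature.NumberTheory.Automorphic (siegelUpperHalfSpace)
open Literature.NumberTheory.ModularForms.SiegelUpperHalfSpace
open Literature.Geometry.Kaehler (ComplexTorus)
open Literature.Geometry.Kaehler.ComplexTorus (proj cover)
open Literature.Geometry.ComplexAnalytic (totalOver)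

namespace Literature.AlgebraicGeometry.ModuliOfAbelianVarieties

variable {g : ℕ} {δ : Fin g → ℕ}

/-! ### §1 The BRIDGE: a period relation `L ∘ Π_Z = Π_{Z′} ∘ M` in REL form gives `Z′ = gDHom(M) • Z` -/

namespace SiegelModuli

/-- The matrix of a `ℂ`-linear automorphism of `ℂ^g` has invertible determinant (plumbing twin of the private helper of ★
`SiegelModuliRelation`). [folklore] -/
private theorem isUnit_det_toMatrix'_equiv (L : (Fin g → ℂ) ≃ₗ[ℂ] (Fin g → ℂ)) :
    IsUnit (LinearMap.toMatrix' (L : (Fin g → ℂ) →ₗ[ℂ] (Fin g → ℂ))).det := by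
  refine isUnit_det_of_left_inverse (B := LinearMap.toMatrix' (L.symm : (Fin g → ℂ) →ₗ[ℂ] _)) ?_
  rw [← LinearMap.toMatrix'_comp,
    show (L.symm : (Fin g → ℂ) →ₗ[ℂ] (Fin g → ℂ)).comp (L : (Fin g → ℂ) →ₗ[ℂ] (Fin g → ℂ)) =
      LinearMap.id from LinearMap.ext fun v ↦ L.symm_apply_apply v, LinearMap.toMatrix'_id]

/-- **THE BRIDGE ([Lange2023AbelianVarietiesComplex] Prop. 3.1.4 (i) ⇒ (ii), pointwise, REL form).**  If a `ℂ`-linear automorphism `L` of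
`ℂ^g` and `M ∈ Sp_δ(ℤ)` satisfy `L (Π_Z w) = Π_{Z′} (M w)` for every real `w` (the relation of ★ `AuxChartGS.Z_equivariant` ∕ of the field
`unif_eq_unif_iff` of ★ `SiegelModuliDatum` ∕ (U2+)), then `gDHom(M) • Z = Z′` for the tree՚s action of `Sp_δ(ℤ)` on `𝔥_g` through Lange՚s
`G_D` (★ `rel_iff_matrix` turns the relation into `L·(Z, Δ) = (Z′, Δ)·M`, ★ `moeb_toGD_eq_of_rel` computes `Z = toGD(M)(Z′)`, and
`toGD(M) = gDHom(M)⁻¹`). [cite: Lange2023AbelianVarietiesComplex, §3.1.2 Prop. 3.1.4; §3.1.4 (3.8)] -/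
theorem gDHom_smul_eq_of_periodMap_rel (hδ : ∀ i, 0 < δ i) {Z Z' : Matrix (Fin g) (Fin g) ℂ}
    (hZ : Z ∈ siegelUpperHalfSpace g) (hZ' : Z' ∈ siegelUpperHalfSpace g)
    {M : GL (Fin g ⊕ Fin g) ℤ} (hM : M ∈ symplecticLatticeGroup δ) (L : (Fin g → ℂ) ≃ₗ[ℂ] (Fin g → ℂ))
    (hrel : ∀ w : Fin g ⊕ Fin g → ℝ, L (siegelPeriodMap δ Z w) = siegelPeriodMap δ Z' (intAct M w)) :
    gDHom δ hδ ⟨M, hM⟩ • (⟨Z, hZ⟩ : siegelUpperHalfSpace g) = ⟨Z', hZ'⟩ := by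
  have hmat := (rel_iff_matrix δ Z Z' (L : (Fin g → ℂ) →ₗ[ℂ] (Fin g → ℂ))
    (M : Matrix (Fin g ⊕ Fin g) (Fin g ⊕ Fin g) ℤ)).1 hrel
  have hZeq := (moeb_toGD_eq_of_rel hδ hZ.1 hZ'.1 (isUnit_det_toMatrix'_equiv L) hmat).symm
  rw [← eq_inv_smul_iff, gDHom_inv]
  apply Subtype.ext
  rw [coe_smul]
  exact hZeq

/-- **The bridge in the `hZZ′` orientation of ★ MRK-UNIQ ∕ MRK-TRANSPORT ∕ MRK-READ**: `Z′ = gDHom(M) • Z`.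
[cite: Lange2023AbelianVarietiesComplex, §3.1.2 Prop. 3.1.4] -/
theorem eq_gDHom_smul_of_periodMap_rel (hδ : ∀ i, 0 < δ i) {Z Z' : Matrix (Fin g) (Fin g) ℂ}
    (hZ : Z ∈ siegelUpperHalfSpace g) (hZ' : Z' ∈ siegelUpperHalfSpace g)
    {M : GL (Fin g ⊕ Fin g) ℤ} (hM : M ∈ symplecticLatticeGroup δ) (L : (Fin g → ℂ) ≃ₗ[ℂ] (Fin g → ℂ))
    (hrel : ∀ w : Fin g ⊕ Fin g → ℝ, L (siegelPeriodMap δ Z w) = siegelPeriodMap δ Z' (intAct M w)) :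
    (⟨Z', hZ'⟩ : siegelUpperHalfSpace g) = gDHom δ hδ ⟨M, hM⟩ • ⟨Z, hZ⟩ :=
  (gDHom_smul_eq_of_periodMap_rel hδ hZ hZ' hM L hrel).symm

/-- **The bridge on the existential shape** of ★ `AuxChartGS.Z_equivariant` ∕ the (U2+) clause `unif_iff` (`∃ M ∈ Γ_δ(N), ∃ L, …`): there is
`M ∈ Γ_δ(N)` (as an element of `Sp_δ(ℤ)`) with `Z′ = gDHom(M) • Z` — the first two conjuncts of ★ `exists_siegelLevelGroup_smul_ratRep_of_lifts`
without any marking. [cite: Lange2023AbelianVarietiesComplex, §3.1.2 Prop. 3.1.4] -/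
theorem exists_eq_gDHom_smul_of_exists_periodMap_rel (hδ : ∀ i, 0 < δ i) {N : ℕ} {Z Z' : Matrix (Fin g) (Fin g) ℂ}
    (hZ : Z ∈ siegelUpperHalfSpace g) (hZ' : Z' ∈ siegelUpperHalfSpace g)
    (h : ∃ M ∈ siegelLevelGroup δ N, ∃ L : (Fin g → ℂ) ≃ₗ[ℂ] (Fin g → ℂ),
      ∀ w : Fin g ⊕ Fin g → ℝ, L (siegelPeriodMap δ Z w) = siegelPeriodMap δ Z' (intAct M w)) :
    ∃ M : symplecticLatticeGroup δ, (M : GL (Fin g ⊕ Fin g) ℤ) ∈ siegelLevelGroup δ N ∧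
      (⟨Z', hZ'⟩ : siegelUpperHalfSpace g) = gDHom δ hδ M • ⟨Z, hZ⟩ := by
  obtain ⟨M, hM, L, hrel⟩ := h
  exact ⟨⟨M, hM.1⟩, hM, eq_gDHom_smul_of_periodMap_rel hδ hZ hZ' hM.1 L hrel⟩

end SiegelModuli

/-! ### §2 MRK-READ with the transport in REL form and the avatars in `Π_Z`-form -/

section Read

variable {N : ℕ} {S : Scheme} {B : AbelianSchemeOver S} {s : Spec (CommRingCat.of ℂ) ⟶ S} {D : B.DualPair}
  {lam : B.X ⟶ D.hat.X} {φ : B.LevelStructure g N} {Θ Θ' : CartierDivisor (B.fibre s).toAbelianVariety.X.left}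
  {r : gspFinAdelic δ} {Z Z' : Matrix (Fin g) (Fin g) ℂ}

open SiegelModuli

/-- **MRK-READ, REL-form transport, `Π`-form avatars** ([Shimura1963AnalyticFamilies] §2 at one fibre on top of [Milne2005ShimuraVarieties]
Thm. 6.11).  Two admissibility data `(m, Θ, Λ)` at `(Z, r)` and `(m′, Θ′, Λ′)` at `(Z′, r)` of ONE fibre, with unit frames `γ = γ′ = 1` and
TAUTOLOGICAL complex coordinates `Ψ = Π_Z`, `Ψ′ = Π_{Z′}` (the (ADM) clause of ★ P-3 `siegelUniversalFamilyUniformisation`); a level transport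
`M ∈ Γ_δ(N)`, `L ∘ Π_Z = Π_{Z′} ∘ M` (★ `AuxChartGS.Z_equivariant`); an integral `A` commuting with `M` and its avatars `C Π_Z = Π_Z A_ℝ`,
`C′ Π_{Z′} = Π_{Z′} A_ℝ` (★ `AuxChartGS.Mρ_kottwitz` at `Z` and at `Z′`).  Then `toFun (π z) = toFun′ (π z′) ⟹ toFun (π (C z)) = toFun′ (π (C′ z′))`
(★ MRK-READ `toFun_cover_apply_eq_of_toFun_cover_eq` after the §1 bridge). [cite: Milne2005ShimuraVarieties, §6 Thm. 6.11 pp. 74–75]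
[cite: Lange2023AbelianVarietiesComplex, §3.1.2 Prop. 3.1.4] [cite: Shimura1963AnalyticFamilies, §2] -/
theorem SiegelAdelicMarking.toFun_cover_apply_eq_of_toFun_cover_eq_of_periodMap_rel (hg : 0 < g) (hδ : IsPolarizationType δ)
    (hN : 3 ≤ N) (hr : r ∈ principalLevelSubgroup δ 1) (hZ : Z ∈ siegelUpperHalfSpace g) (hZ' : Z' ∈ siegelUpperHalfSpace g)
    (m : SiegelAdelicMarking ⟨jOfSiegel δ Z, SiegelComplexRecordSystem.jOfSiegel_mem_C0pm hδ.1 hZ⟩ r (B.fibre s).toAbelianVariety)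
    (Λ : φ.SymplecticLift s Θ δ) (hΘl : B.IsLambdaOfAt s D lam Θ)
    (hΛ : ∀ ⦃M : ℕ⦄, N ∣ M → M ≠ 0 → ∀ (x : Fin g ⊕ Fin g → ZMod M) (v : Fin g ⊕ Fin g → ℚ),
      AdelicCongr ((r⁻¹ : gspFinAdelic δ) : GL (Fin g ⊕ Fin g) finAdeleQ) 1 v (fun i => ((x i).val : ℚ) / M) →
        ((Λ.lift M (Multiplicative.ofAdd x)) : (B.fibre s).toAbelianVariety.Points ℂ) = m.r v)
    (m' : SiegelAdelicMarking ⟨jOfSiegel δ Z', SiegelComplexRecordSystem.jOfSiegel_mem_C0pm hδ.1 hZ'⟩ r (B.fibre s).toAbelianVariety)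
    (Λ' : φ.SymplecticLift s Θ' δ) (hΘl' : B.IsLambdaOfAt s D lam Θ')
    (hΛ' : ∀ ⦃M : ℕ⦄, N ∣ M → M ≠ 0 → ∀ (x : Fin g ⊕ Fin g → ZMod M) (v : Fin g ⊕ Fin g → ℚ),
      AdelicCongr ((r⁻¹ : gspFinAdelic δ) : GL (Fin g ⊕ Fin g) finAdeleQ) 1 v (fun i => ((x i).val : ℚ) / M) →
        ((Λ'.lift M (Multiplicative.ofAdd x)) : (B.fibre s).toAbelianVariety.Points ℂ) = m'.r v)
    {M : GL (Fin g ⊕ Fin g) ℤ} (hM : M ∈ siegelLevelGroup δ N) (L : (Fin g → ℂ) ≃ₗ[ℂ] (Fin g → ℂ))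
    (hrel : ∀ w : Fin g ⊕ Fin g → ℝ, L (siegelPeriodMap δ Z w) = siegelPeriodMap δ Z' (intAct M w))
    (hγ : m.γ = 1) (hγ' : m'.γ = 1)
    (hΨ : ∀ v : Fin g ⊕ Fin g → ℝ, m.Ψ v = siegelPeriodMap δ Z v) (hΨ' : ∀ v : Fin g ⊕ Fin g → ℝ, m'.Ψ v = siegelPeriodMap δ Z' v)
    (A : Matrix (Fin g ⊕ Fin g) (Fin g ⊕ Fin g) ℤ)
    (hMA : (M : Matrix (Fin g ⊕ Fin g) (Fin g ⊕ Fin g) ℤ) * A = A * (M : Matrix (Fin g ⊕ Fin g) (Fin g ⊕ Fin g) ℤ))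
    (C C' : (Fin g → ℂ) → (Fin g → ℂ))
    (hC : ∀ u : Fin g ⊕ Fin g → ℝ, C (siegelPeriodMap δ Z u) = siegelPeriodMap δ Z ((A.map (Int.cast : ℤ → ℝ)) *ᵥ u))
    (hC' : ∀ u : Fin g ⊕ Fin g → ℝ, C' (siegelPeriodMap δ Z' u) = siegelPeriodMap δ Z' ((A.map (Int.cast : ℤ → ℝ)) *ᵥ u))
    {z z' : Fin g → ℂ} (h : m.toFun (cover m.Ψ z) = m'.toFun (cover m'.Ψ z')) :
    m.toFun (cover m.Ψ (C z)) = m'.toFun (cover m'.Ψ (C' z')) :=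
  SiegelAdelicMarking.toFun_cover_apply_eq_of_toFun_cover_eq hg hδ hN hr hZ hZ' m Λ hΘl hΛ m' Λ' hΘl' hΛ' ⟨M, hM.1⟩ hM
    (eq_gDHom_smul_of_periodMap_rel hδ.1 hZ hZ' hM.1 L hrel) hγ hγ' A hMA C C'
    (fun x => by rw [hΨ, hC, hΨ]) (fun x => by rw [hΨ', hC', hΨ']) h

/-! ### §3 THE HEAD: chart fibre maps read in a total space — E6-an′՚s `hcompat` at one point -/

/-- **COV-5 HEAD, injective-reading form.**  Same setting as §2; in addition the two torus maps ARE, through an injective reading `ℓ` of a type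
`Q` in the points of the abelian scheme, the fibre maps `e, e′ : ℂ^g → Q` of two charts: `fibrePointToLeft s (toFun (π z)) = ℓ (e z)`,
`fibrePointToLeft s (toFun′ (π z′)) = ℓ (e′ z′)` (the last (ADM) conjunct of ★ P-3 with `Q := MA`, `ℓ q := (φA q).left`).  Then
`e z = e′ z′ ⟹ e (C z) = e′ (C′ z′)` — the `hcompat` hypothesis of ★ E6-an′ `AbelianSchemeOver.exists_isMonHom_of_chartReadings_of_additive`
for this pair of charts at this point (★ `fibrePointToLeft_injective`). [cite: Milne2005ShimuraVarieties, §6 Thm. 6.11 pp. 74–75]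
[cite: Shimura1963AnalyticFamilies, §2] -/
theorem SiegelAdelicMarking.chart_apply_eq_of_chart_eq_of_periodMap_rel (hg : 0 < g) (hδ : IsPolarizationType δ)
    (hN : 3 ≤ N) (hr : r ∈ principalLevelSubgroup δ 1) (hZ : Z ∈ siegelUpperHalfSpace g) (hZ' : Z' ∈ siegelUpperHalfSpace g)
    (m : SiegelAdelicMarking ⟨jOfSiegel δ Z, SiegelComplexRecordSystem.jOfSiegel_mem_C0pm hδ.1 hZ⟩ r (B.fibre s).toAbelianVariety)
    (Λ : φ.SymplecticLift s Θ δ) (hΘl : B.IsLambdaOfAt s D lam Θ)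
    (hΛ : ∀ ⦃M : ℕ⦄, N ∣ M → M ≠ 0 → ∀ (x : Fin g ⊕ Fin g → ZMod M) (v : Fin g ⊕ Fin g → ℚ),
      AdelicCongr ((r⁻¹ : gspFinAdelic δ) : GL (Fin g ⊕ Fin g) finAdeleQ) 1 v (fun i => ((x i).val : ℚ) / M) →
        ((Λ.lift M (Multiplicative.ofAdd x)) : (B.fibre s).toAbelianVariety.Points ℂ) = m.r v)
    (m' : SiegelAdelicMarking ⟨jOfSiegel δ Z', SiegelComplexRecordSystem.jOfSiegel_mem_C0pm hδ.1 hZ'⟩ r (B.fibre s).toAbelianVariety)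
    (Λ' : φ.SymplecticLift s Θ' δ) (hΘl' : B.IsLambdaOfAt s D lam Θ')
    (hΛ' : ∀ ⦃M : ℕ⦄, N ∣ M → M ≠ 0 → ∀ (x : Fin g ⊕ Fin g → ZMod M) (v : Fin g ⊕ Fin g → ℚ),
      AdelicCongr ((r⁻¹ : gspFinAdelic δ) : GL (Fin g ⊕ Fin g) finAdeleQ) 1 v (fun i => ((x i).val : ℚ) / M) →
        ((Λ'.lift M (Multiplicative.ofAdd x)) : (B.fibre s).toAbelianVariety.Points ℂ) = m'.r v)
    {M : GL (Fin g ⊕ Fin g) ℤ} (hM : M ∈ siegelLevelGroup δ N) (L : (Fin g → ℂ) ≃ₗ[ℂ] (Fin g → ℂ))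
    (hrel : ∀ w : Fin g ⊕ Fin g → ℝ, L (siegelPeriodMap δ Z w) = siegelPeriodMap δ Z' (intAct M w))
    (hγ : m.γ = 1) (hγ' : m'.γ = 1)
    (hΨ : ∀ v : Fin g ⊕ Fin g → ℝ, m.Ψ v = siegelPeriodMap δ Z v) (hΨ' : ∀ v : Fin g ⊕ Fin g → ℝ, m'.Ψ v = siegelPeriodMap δ Z' v)
    (A : Matrix (Fin g ⊕ Fin g) (Fin g ⊕ Fin g) ℤ)
    (hMA : (M : Matrix (Fin g ⊕ Fin g) (Fin g ⊕ Fin g) ℤ) * A = A * (M : Matrix (Fin g ⊕ Fin g) (Fin g ⊕ Fin g) ℤ))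
    (C C' : (Fin g → ℂ) → (Fin g → ℂ))
    (hC : ∀ u : Fin g ⊕ Fin g → ℝ, C (siegelPeriodMap δ Z u) = siegelPeriodMap δ Z ((A.map (Int.cast : ℤ → ℝ)) *ᵥ u))
    (hC' : ∀ u : Fin g ⊕ Fin g → ℝ, C' (siegelPeriodMap δ Z' u) = siegelPeriodMap δ Z' ((A.map (Int.cast : ℤ → ℝ)) *ᵥ u))
    {Q : Type*} (ℓ : Q → (Spec (CommRingCat.of ℂ) ⟶ B.X.left)) (hℓ : Function.Injective ℓ) (e e' : (Fin g → ℂ) → Q)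
    (hex : ∀ z : Fin g → ℂ, B.fibrePointToLeft s (m.toFun (cover m.Ψ z)) = ℓ (e z))
    (hex' : ∀ z : Fin g → ℂ, B.fibrePointToLeft s (m'.toFun (cover m'.Ψ z)) = ℓ (e' z))
    {z z' : Fin g → ℂ} (h : e z = e' z') : e (C z) = e' (C' z') := by
  -- the two torus maps mark the same point of the fibre
  have h0 : m.toFun (cover m.Ψ z) = m'.toFun (cover m'.Ψ z') :=
    AbelianSchemeOver.fibrePointToLeft_injective (B := B) s (by rw [hex, hex', h])
  have h1 := SiegelAdelicMarking.toFun_cover_apply_eq_of_toFun_cover_eq_of_periodMap_rel hg hδ hN hr hZ hZ' m Λ hΘl hΛ m' Λ' hΘl'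
    hΛ' hM L hrel hγ hγ' hΨ hΨ' A hMA C C' hC hC' h0
  exact hℓ (by rw [← hex, ← hex', h1])

end Read

/-! ### §3′ THE HEAD in the currency of ★ P-3 ∕ ★ E6-an′: readings through an injective analytification `φA` of the total space -/

section Total

variable {N : ℕ} {T : SchemeOver ℂ} {B : AbelianSchemeOver T.left} {s : Spec (CommRingCat.of ℂ) ⟶ T.left} {D : B.DualPair}
  {lam : B.X ⟶ D.hat.X} {φ : B.LevelStructure g N} {Θ Θ' : CartierDivisor (B.fibre s).toAbelianVariety.X.left}
  {r : gspFinAdelic δ} {Z Z' : Matrix (Fin g) (Fin g) ℂ}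

open SiegelModuli

/-- **COV-5 HEAD, total-space form** (the tokens of ★ P-3 `siegelUniversalFamilyUniformisation` (ADM) and of ★ E6-an′ `hcompat`).  For an
abelian scheme `B` over a complex base `T`, an injective `φA : MA → (totalOver T B)(ℂ)` (an analytification is a homeomorphism), two chart
fibre maps `e, e′ : ℂ^g → MA` at the point `s` which ARE the torus maps of two admissibility data at `(Z, r)`, `(Z′, r)` with unit frames and
tautological coordinates (`fibrePointToLeft s (toFun (π z)) = (φA (e z)).left`, the last (ADM) conjunct), a level transport `M ∈ Γ_δ(N)`,
`L ∘ Π_Z = Π_{Z′} ∘ M` commuting with an integral `A`, and the avatars `C`, `C′` of `A` at `Z`, `Z′`: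
`e z = e′ z′ ⟹ e (C z) = e′ (C′ z′)`.  In Σ-AN: `T := X_ℂ`∕a piece, `B := P_T.A`, `s := (φT t).left`, `e := ex (t, ·)`, `e′ := ex′ (t, ·)`,
`(M, L)` from ★ `AuxChartGS.Z_equivariant` (via §4), `A := Mρ a b`, `C, C′` from ★ `AuxChartGS.Mρ_kottwitz`.
[cite: Milne2005ShimuraVarieties, §6 Thm. 6.11 pp. 74–75] [cite: Lange2023AbelianVarietiesComplex, §3.1.2 Prop. 3.1.4]
[cite: Shimura1963AnalyticFamilies, §2] -/
theorem SiegelAdelicMarking.chart_apply_eq_of_chart_eq_of_periodMap_rel_of_injective (hg : 0 < g) (hδ : IsPolarizationType δ)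
    (hN : 3 ≤ N) (hr : r ∈ principalLevelSubgroup δ 1) (hZ : Z ∈ siegelUpperHalfSpace g) (hZ' : Z' ∈ siegelUpperHalfSpace g)
    (m : SiegelAdelicMarking ⟨jOfSiegel δ Z, SiegelComplexRecordSystem.jOfSiegel_mem_C0pm hδ.1 hZ⟩ r (B.fibre s).toAbelianVariety)
    (Λ : φ.SymplecticLift s Θ δ) (hΘl : B.IsLambdaOfAt s D lam Θ)
    (hΛ : ∀ ⦃M : ℕ⦄, N ∣ M → M ≠ 0 → ∀ (x : Fin g ⊕ Fin g → ZMod M) (v : Fin g ⊕ Fin g → ℚ),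
      AdelicCongr ((r⁻¹ : gspFinAdelic δ) : GL (Fin g ⊕ Fin g) finAdeleQ) 1 v (fun i => ((x i).val : ℚ) / M) →
        ((Λ.lift M (Multiplicative.ofAdd x)) : (B.fibre s).toAbelianVariety.Points ℂ) = m.r v)
    (m' : SiegelAdelicMarking ⟨jOfSiegel δ Z', SiegelComplexRecordSystem.jOfSiegel_mem_C0pm hδ.1 hZ'⟩ r (B.fibre s).toAbelianVariety)
    (Λ' : φ.SymplecticLift s Θ' δ) (hΘl' : B.IsLambdaOfAt s D lam Θ')
    (hΛ' : ∀ ⦃M : ℕ⦄, N ∣ M → M ≠ 0 → ∀ (x : Fin g ⊕ Fin g → ZMod M) (v : Fin g ⊕ Fin g → ℚ),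
      AdelicCongr ((r⁻¹ : gspFinAdelic δ) : GL (Fin g ⊕ Fin g) finAdeleQ) 1 v (fun i => ((x i).val : ℚ) / M) →
        ((Λ'.lift M (Multiplicative.ofAdd x)) : (B.fibre s).toAbelianVariety.Points ℂ) = m'.r v)
    {M : GL (Fin g ⊕ Fin g) ℤ} (hM : M ∈ siegelLevelGroup δ N) (L : (Fin g → ℂ) ≃ₗ[ℂ] (Fin g → ℂ))
    (hrel : ∀ w : Fin g ⊕ Fin g → ℝ, L (siegelPeriodMap δ Z w) = siegelPeriodMap δ Z' (intAct M w))
    (hγ : m.γ = 1) (hγ' : m'.γ = 1)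
    (hΨ : ∀ v : Fin g ⊕ Fin g → ℝ, m.Ψ v = siegelPeriodMap δ Z v) (hΨ' : ∀ v : Fin g ⊕ Fin g → ℝ, m'.Ψ v = siegelPeriodMap δ Z' v)
    (A : Matrix (Fin g ⊕ Fin g) (Fin g ⊕ Fin g) ℤ)
    (hMA : (M : Matrix (Fin g ⊕ Fin g) (Fin g ⊕ Fin g) ℤ) * A = A * (M : Matrix (Fin g ⊕ Fin g) (Fin g ⊕ Fin g) ℤ))
    (C C' : (Fin g → ℂ) → (Fin g → ℂ))
    (hC : ∀ u : Fin g ⊕ Fin g → ℝ, C (siegelPeriodMap δ Z u) = siegelPeriodMap δ Z ((A.map (Int.cast : ℤ → ℝ)) *ᵥ u))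
    (hC' : ∀ u : Fin g ⊕ Fin g → ℝ, C' (siegelPeriodMap δ Z' u) = siegelPeriodMap δ Z' ((A.map (Int.cast : ℤ → ℝ)) *ᵥ u))
    {MA : Type*} (φA : MA → ComplexPoints (totalOver T B)) (hφA : Function.Injective φA) (e e' : (Fin g → ℂ) → MA)
    (hex : ∀ z : Fin g → ℂ, B.fibrePointToLeft s (m.toFun (cover m.Ψ z)) = (φA (e z)).left)
    (hex' : ∀ z : Fin g → ℂ, B.fibrePointToLeft s (m'.toFun (cover m'.Ψ z)) = (φA (e' z)).left)
    {z z' : Fin g → ℂ} (h : e z = e' z') : e (C z) = e' (C' z') :=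
  SiegelAdelicMarking.chart_apply_eq_of_chart_eq_of_periodMap_rel hg hδ hN hr hZ hZ' m Λ hΘl hΛ m' Λ' hΘl' hΛ' hM L hrel hγ hγ'
    hΨ hΨ' A hMA C C' hC hC' (fun q : MA => (φA q).left)
    (fun _ _ hq => hφA (Over.OverMorphism.ext hq)) e e' hex hex' h

end Total

/-! ### §4 Level transport of two lifts on a ball-quotient piece (the `Z_equivariant` binder shape) -/

/-- **Two lifts of ONE point of a ball-quotient piece differ by a level element, read in an `L`-rational level.**  For a ball
uniformisation datum `B` of a complex curve `X` ([BergeronMillsonMoeglin2016Balls] Part 2 §1: `X(ℂ) = Γ_B∖𝔹`, field `unif_eq_unif_iff`) whose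
ball level `Γ_B ≤ GL₂(E)` is identified through `τ₁` with the image under `τ : L → ℂ` of a subgroup `Γ′ ≤ GL₂(L)` (the second conjunct of the
`pieces` clause of ★ `RecordSystemGS`, `Γ′ =` the arithmetic level of the piece), two vectors `v, v′` of the negative cone with
`unif v = unif v′` satisfy `γ^{τ} v = c • v′` for some `γ ∈ Γ′` and `c ≠ 0` — the binder shape of ★ `AuxChartGS.Z_equivariant`.
[cite: BergeronMillsonMoeglin2016Balls, Part 2 §§1.1–1.4] -/
theorem _root_.Literature.AlgebraicGeometry.ShimuraVarieties.UnitaryBallUniformisationDatum.exists_mem_map_mulVec_eq_smul_of_unif_eq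
    {p : ℕ} {X : SchemeOver ℂ}
    (B : Literature.AlgebraicGeometry.ShimuraVarieties.UnitaryBallUniformisationDatum p X)
    {L : Type*} [CommRing L] (τ : L →+* ℂ) (Γ' : Subgroup (GL (Fin (p + 1)) L))
    (hΓ : B.Γ.map (Matrix.GeneralLinearGroup.map (B.τ₁ : ↥B.E →+* ℂ)) = Γ'.map (Matrix.GeneralLinearGroup.map τ))
    {v v' : Fin (p + 1) → ℂ} (hv : v ∈ Literature.AlgebraicGeometry.ShimuraVarieties.negCone B.Hℂ)
    (hv' : v' ∈ Literature.AlgebraicGeometry.ShimuraVarieties.negCone B.Hℂ) (h : B.unif v = B.unif v') :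
    ∃ γ ∈ Γ', ∃ c : ℂ, c ≠ 0 ∧ ((γ : Matrix (Fin (p + 1)) (Fin (p + 1)) L).map τ) *ᵥ v = c • v' := by
  obtain ⟨γ₀, hγ₀, c, hc, hγv⟩ := (B.unif_eq_unif_iff v hv v' hv').1 h
  have hmem : Matrix.GeneralLinearGroup.map (B.τ₁ : ↥B.E →+* ℂ) γ₀ ∈ Γ'.map (Matrix.GeneralLinearGroup.map τ) := by
    rw [← hΓ]; exact Subgroup.mem_map_of_mem _ hγ₀
  obtain ⟨γ, hγ, hγeq⟩ := Subgroup.mem_map.1 hmem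
  refine ⟨γ, hγ, c, hc, ?_⟩
  have hcoe : ((γ : Matrix (Fin (p + 1)) (Fin (p + 1)) L).map τ) =
      ((γ₀ : Matrix (Fin (p + 1)) (Fin (p + 1)) B.E).map B.τ₁) := by
    have h1 := congrArg (fun u : GL (Fin (p + 1)) ℂ => (u : Matrix (Fin (p + 1)) (Fin (p + 1)) ℂ)) hγeq
    simpa [Matrix.GeneralLinearGroup.map, RingHom.mapMatrix_apply] using h1
  rw [hcoe]
  exact hγv

end Literature.AlgebraicGeometry.ModuliOfAbelianVarieties

end
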